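import Summits.NavierStokesRegularity.FluidComputer.GateBudgetColdIncrementSharp
import HarnessLib

/-!
# GateBudget part 87 (file 2/2) — the sharp cold half, loss `37(|d(T')| + 4/K⁹)/K⁹` (§254–§255)

Cell `pub-fluidc`, blueprint seat bp1 (gen 37, fourth item: SPEC-INPUT-bp1 §BO(4)(a)); namespace
`Summit.NavierStokesRegularity.FluidComputer.GateBudget`, headline member
`RotorKnob.rotorCircuit K K¹⁰ ε ρ` from `delayInit` (5.6), `K ≥ 16`, lattice window
`200ε/K²⁰ ≤ ρ² ≤ 2ε/K¹⁰`, `ε² ≤ 1/(6K²⁰)` (`σ = ρ²e^{-K¹⁰}`, `μ = ε⁻¹K¹⁰`); modes `0 = a`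
(carrier), `1 = b` (clock), `2 = c` (trigger), `3 = d` (transfer), `4 = ã` (output),
`P = d² + ã²`. Imports file 1/2 (`GateBudgetColdIncrementSharp`, §252–§253), hence part 84.
HONEST FRAMING: a low prior, high value-of-information experiment on Tao's machine paradigm;
NOT a claim that NS blows up. Nothing whatsoever is proved about the Navier–Stokes equations.
[cite: Tao2016AveragedNS, §5.5 Theorem 5.3, (5.5), (5.6), (b-eq), (c-eq), (d-eq), (ta-eq),
(energy-con), (est)]

WHY (SPEC-INPUT-bp1 §BO(4)(a)). With the sharp slopes `s_l' = 1 - P₀ - 6d₁/K⁹ - 1/K¹⁹`,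
`s_u' = 1 - P₀ + 6d₁/K⁹` of file 1/2 (`d₁ = |d(T')| + 3/K⁹` from part 84 §247) the debt branch
of part 62 §193 loses `2θ₁(s_u' - s_l')/s_u' ≤ 37(d₁ + 1/K⁹)/K⁹` instead of `43/K⁹`
(`37 = ⌈2·(3/2)·12/0.98⌉`); the seed branch converts with `s_l' = s_u - q'`, `q' ≤ 13/K⁹`.
Nothing of parts 57–62 is re-run: window, clock zero, relight time, the clip `1.39999`, the
upper side `1.41422`, pair law, duration, damping and growth are part 84 §247's conclusions,
kept verbatim; only the lower alternative is re-read.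

WHAT IS PROVED. §254 `theta_lower_sharp` (real arithmetic): `0 < x` and
`θ - 37(d₁ + 1/K⁹)/K⁹ ≤ x ∨ 2(1 - P₀) - 65/K⁹ ≤ x²`. §255 `knob_cold_half_sharp`: part 84 §247
VERBATIM (`∃ tz r' θ'`, window `c ≤ ρ²/K⁹` on `[T', r']`, `c(r') = ρ²/K⁹`, `b(tz) = 0`,
`T' + 1 ≤ tz < r' < T' + 3`, `b(r') = θ'ε`, `θ' ≤ 1.41422`, `|P(r') - P(T')| ≤
6(|d(T')| + 3/K⁹)/K⁹`, `9/4 ≤ r' - T'`, damping, growth, `|d| ≤ |d(T')| + 3/K⁹`) except that the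
lower alternative reads `θ₁ - 37(|d(T')| + 4/K⁹)/K⁹ ≤ θ' ∨ 1.39999 ≤ θ'`. Honest limits: the
loss is `O(1/K¹³)` only ON THE LADDER (`|d(T')| ≤ 7/K⁴ + ι`); from an arbitrary dousing state
with `P(T') ≤ 1/50` it is `≤ 37(1/7 + 4/K⁹)/K⁹ ≈ 5.3/K⁹`; existence of `(tz, r', θ')`, no
uniqueness; the pulse side `242 log K/K¹⁰` is now the whole per-rung clock loss up to
`O(1/K¹³)` (parts 88/89 re-run climb and horizon); nothing about Navier–Stokes.
-/

noncomputable section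

namespace Summit.NavierStokesRegularity.FluidComputer.GateBudget

open Real Set
open Literature.Analysis.FluidPDE.Tao2016AveragedNS

variable {K ε ρ : ℝ} {X : ℝ → Fin 5 → ℝ}

/-! ## §254 The sharp relight arithmetic -/

/-- §254 THE SHARP LOWER SIDE (real arithmetic): with `s_l' = 1 - P₀ - 6d₁/K⁹ - 1/K¹⁹`,
`s_u' = 1 - P₀ + 6d₁/K⁹`, `s_u = 1 - P₀ + 6/K⁹` (`0 ≤ P₀ ≤ 1/50`, `0 ≤ d₁ ≤ 1`, `θ ≤ 3/2`,
`K ≥ 16`): if `s_l'(tz - T) ≤ θ`, `tz < r`, the relight ratio `x ≥ s_l'(r - tz)` and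
(`r > T + 2θ/s_u'` or `s_u(r - tz)²/2 > 1 - 10 log K/K¹⁰`), then `0 < x` and
`θ - 37(d₁ + 1/K⁹)/K⁹ ≤ x ∨ 2(1 - P₀) - 65/K⁹ ≤ x²` (debt: `x > θ(2s_l'/s_u' - 1)`,
`2θ(s_u' - s_l')/s_u' ≤ 3.07(12d₁/K⁹ + 1/K¹⁹)`; seed: `s_l' ≥ s_u - 13/K⁹`, part 62 §193).
[derived: this file §254] -/
theorem theta_lower_sharp {K P₀ θ T tz r x d₁ : ℝ} (hK : 16 ≤ K) (hP0 : 0 ≤ P₀)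
    (hP : P₀ ≤ 1 / 50) (hθ2 : θ ≤ 3 / 2) (hd0 : 0 ≤ d₁) (hd1 : d₁ ≤ 1)
    (htz : (1 - P₀ - 6 * d₁ / K ^ 9 - 1 / K ^ 19) * (tz - T) ≤ θ) (htr : tz < r)
    (hlow : T + 2 * θ / (1 - P₀ + 6 * d₁ / K ^ 9) < r ∨
      1 - 10 * log K / K ^ 10 < (1 - P₀ + 6 / K ^ 9) * (r - tz) ^ 2 / 2)
    (hx : (1 - P₀ - 6 * d₁ / K ^ 9 - 1 / K ^ 19) * (r - tz) ≤ x) :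
    0 < x ∧ (θ - 37 * (d₁ + 1 / K ^ 9) / K ^ 9 ≤ x ∨ 2 * (1 - P₀) - 65 / K ^ 9 ≤ x ^ 2) := by
  have hK0 : (0 : ℝ) < K := by linarith
  have hK9 : (0 : ℝ) < K ^ 9 := by positivity
  have hK10 : (0 : ℝ) < K ^ 10 := by positivity
  have h169 : (16 : ℝ) ^ 9 ≤ K ^ 9 := pow_le_pow_left₀ (by norm_num) hK 9
  obtain ⟨-, -, hso1, hso2, -, hlog, hm0, -⟩ := ledger_slopes hK hP0 hP
  -- names: `q = 1/K⁹`, `p = 1/K¹⁹`, `sl = s_l'`, `su = s_u'`, `so = s_u` (old), `m`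
  obtain ⟨q, hq⟩ : ∃ q : ℝ, q = 1 / K ^ 9 := ⟨_, rfl⟩
  obtain ⟨p, hp⟩ : ∃ p : ℝ, p = 1 / K ^ 19 := ⟨_, rfl⟩
  have hq0 : 0 < q := by rw [hq]; positivity
  have hq1 : q ≤ 1 / 10 ^ 10 := by
    rw [hq, div_le_div_iff₀ hK9 (by norm_num)]; linarith only [h169]
  have hp0 : 0 ≤ p := by rw [hp]; positivity
  have hpq : p ≤ q * q / 16 := by
    have e : q * q / 16 = 1 / (16 * K ^ 18) := by rw [hq]; ring
    rw [hp, e]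
    apply one_div_le_one_div_of_le (by positivity)
    have h18 : (0 : ℝ) < K ^ 18 := by positivity
    nlinarith [h18, hK]
  obtain ⟨sl, hsl_def⟩ : ∃ sl : ℝ, sl = 1 - P₀ - 6 * d₁ / K ^ 9 - 1 / K ^ 19 := ⟨_, rfl⟩
  obtain ⟨su, hsu_def⟩ : ∃ su : ℝ, su = 1 - P₀ + 6 * d₁ / K ^ 9 := ⟨_, rfl⟩
  obtain ⟨so, hso_def⟩ : ∃ so : ℝ, so = 1 - P₀ + 6 / K ^ 9 := ⟨_, rfl⟩
  obtain ⟨m, hm_def⟩ : ∃ m : ℝ, m = 1 - 10 * log K / K ^ 10 := ⟨_, rfl⟩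
  have hsl_q : sl = 1 - P₀ - 6 * (d₁ * q) - p := by rw [hsl_def, hq, hp]; ring
  have hsu_q : su = 1 - P₀ + 6 * (d₁ * q) := by rw [hsu_def, hq]; ring
  have hso_q : so = 1 - P₀ + 6 * q := by rw [hso_def, hq]; ring
  simp only [← hsl_def, ← hsu_def, ← hso_def, ← hm_def] at htz hlow hx hso1 hso2 hm0
  have hd1q : 0 ≤ d₁ * q := mul_nonneg hd0 hq0.le
  have hdq : d₁ * q ≤ q := by nlinarith only [hd1, hq0]
  have hqq : q * q ≤ q := by nlinarith only [hq1, hq0]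
  have hsl1 : 9799 / 10000 ≤ sl := by
    rw [hsl_q]; nlinarith only [hP, hdq, hq1, hpq, hqq]
  have hsl0 : 0 < sl := by linarith only [hsl1]
  have hsu1 : 98 / 100 ≤ su := by rw [hsu_q]; linarith only [hP, hd1q]
  have hsu0 : 0 < su := by linarith only [hsu1]
  have hw : su - sl = 12 * (d₁ * q) + p := by rw [hsl_q, hsu_q]; ring
  have hwr : 0 < r - tz := by linarith only [htr]
  have hx0 : 0 < x := lt_of_lt_of_le (mul_pos hsl0 hwr) hx
  refine ⟨hx0, ?_⟩
  rcases hlow with h | h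
  · -- debt branch: `x > sl(2θ/su - θ/sl) = θ - 2θ(su - sl)/su ≥ θ - 37(d₁ + q)q`
    left
    have h0 : sl * (2 * θ / su) < sl * (r - T) := mul_lt_mul_of_pos_left (by linarith [h]) hsl0
    have e1 : sl * (2 * θ / su) = 2 * θ - 2 * θ * (su - sl) / su := by
      field_simp
      ring
    have h1 : θ - 2 * θ * (su - sl) / su < x := by nlinarith only [h0, e1, htz, hx]
    rw [hw] at h1
    have hpos : 0 ≤ 12 * (d₁ * q) + p := by positivity
    have hA : 2 * θ * (12 * (d₁ * q) + p) ≤ 3 * (12 * (d₁ * q) + p) := by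
      nlinarith only [hθ2, hpos]
    have hB : 3 * (12 * (d₁ * q) + p) ≤ 37 * (d₁ + q) * q * (98 / 100) := by
      nlinarith only [hpq, hd1q, hq0, hqq]
    have hC : 37 * (d₁ + q) * q * (98 / 100) ≤ 37 * (d₁ + q) * q * su :=
      mul_le_mul_of_nonneg_left hsu1 (by positivity)
    have h2 : 2 * θ * (12 * (d₁ * q) + p) / su ≤ 37 * (d₁ + q) * q := by
      rw [div_le_iff₀ hsu0]; linarith only [hA, hB, hC]
    have e2 : 37 * (d₁ + 1 / K ^ 9) / K ^ 9 = 37 * (d₁ + q) * q := by rw [hq]; ring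
    rw [e2]
    linarith only [h1, h2]
  · -- seed branch: `x² ≥ sl²(r - tz)² > 2m·sl²/so ≥ 2(1 - P₀) - 65/K⁹` (part 62 §193)
    right
    have h1 : (sl * (r - tz)) ^ 2 ≤ x ^ 2 :=
      pow_le_pow_left₀ (mul_nonneg hsl0.le hwr.le) hx 2
    have hso0 : 0 < so := by linarith only [hso1]
    have h2 : 2 * m < so * (r - tz) ^ 2 := by linarith only [h]
    have h3 : 2 * m * sl ^ 2 < so * (sl * (r - tz)) ^ 2 := by
      have h4 := mul_lt_mul_of_pos_right h2 (pow_pos hsl0 2)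
      nlinarith only [h4]
    obtain ⟨q', hq'⟩ : ∃ q' : ℝ, q' = 6 * q + 6 * (d₁ * q) + p := ⟨_, rfl⟩
    have hslq' : sl = so - q' := by rw [hsl_q, hso_q, hq']; ring
    have hq'0 : 0 ≤ q' := by rw [hq']; positivity
    have hq'13 : q' ≤ 13 * q := by rw [hq']; nlinarith only [hdq, hpq, hqq]
    have h4 : so * (so - 2 * q') ≤ sl ^ 2 := by rw [hslq']; nlinarith only [sq_nonneg q']
    have h5 : 2 * m * (so * (so - 2 * q')) ≤ 2 * m * sl ^ 2 :=
      mul_le_mul_of_nonneg_left h4 (by linarith only [hm0])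
    have h6 : 2 * m * (so - 2 * q') < (sl * (r - tz)) ^ 2 := by
      have h7 : so * (2 * m * (so - 2 * q')) < so * (sl * (r - tz)) ^ 2 := by
        nlinarith only [h3, h5]
      exact lt_of_mul_lt_mul_left h7 hso0.le
    have h8 : 10 * log K / K ^ 10 ≤ 10 * q := by
      rw [hq, div_le_iff₀ hK10]
      have e : 10 * (1 / K ^ 9) * K ^ 10 = 10 * K := by field_simp
      rw [e]
      linarith only [hlog]
    have hmq : 1 - 10 * q ≤ m := by rw [hm_def]; linarith only [h8]
    have hsq0 : 0 ≤ so - 2 * q' := by linarith only [hso1, hq'13, hq1]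
    have h9 : 2 * (so - 2 * q') - 2 * (so - 2 * q') * (10 * q) ≤ 2 * m * (so - 2 * q') := by
      nlinarith only [hmq, hsq0]
    have h10 : 2 * (so - 2 * q') * (10 * q) ≤ 21 * q := by
      nlinarith only [hso2, hq'0, hq0]
    have h11 : 2 * (1 - P₀) - 65 / K ^ 9 ≤ 2 * so - 4 * q' - 21 * q := by
      have e : (65 : ℝ) / K ^ 9 = 65 * q := by rw [hq]; ring
      rw [e, hso_q]
      linarith only [hq'13, hq0]
    linarith only [h1, h6, h9, h10, h11]

/-! ## §255 The sharp cold half -/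

/-- §255 THE SHARP COLD HALF: part 84 §247 `knob_cold_half_clock` VERBATIM — after a dousing at
`T'` (`b(T') = -θ₁ε`, `1.249 ≤ θ₁ ≤ 3/2`, `P(T') ≤ 1/50`, `ℓ' ≤ c(T') ≤ 2ρ²/K¹⁰`,
`ã(T') ≥ 0`) the clock zero `tz ≥ T' + 1`, the relight `r' ∈ (tz, T' + 3)` with `c ≤ ρ²/K⁹` on
`[T', r']` and `c(r') = ρ²/K⁹`, the relight ratio `b(r') = θ'ε` with `θ' ≤ 1.41422`, the pair
to `6(|d(T')| + 3/K⁹)/K⁹`, the duration `r' - T' ≥ 9/4`, the cold damping of `d`, the growth of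
`ã` and `|d| ≤ |d(T')| + 3/K⁹` on the window — EXCEPT that the lower alternative is the sharp
one: `θ' ≥ θ₁ - 37(|d(T')| + 4/K⁹)/K⁹` or `θ' ≥ 1.39999` (§252–§254 with
`d₁ = |d(T')| + 3/K⁹`, `P₀ = P(T')`, on part 84's own window). [derived: this file §255] -/
theorem knob_cold_half_sharp
    (hX : ∀ t, HasDerivAt X (RotorKnob.rotorCircuit K (K ^ 10) ε ρ (X t)) t)
    (h0 : X 0 = delayInit) (hK : 16 ≤ K) (hε : 0 < ε) (hεK : ε ^ 2 ≤ 1 / (6 * K ^ 20))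
    (hρ : 0 < ρ) (hhi : K ^ 10 * ρ ^ 2 ≤ 2 * ε) {T' θ₁ : ℝ} (hT'0 : 0 ≤ T')
    (hθ1 : 1249 / 1000 ≤ θ₁) (hθ2 : θ₁ ≤ 3 / 2) (hbT : X T' 1 = -(θ₁ * ε))
    (hP : X T' 3 ^ 2 + X T' 4 ^ 2 ≤ 1 / 50) (hℓ : ρ ^ 2 / K ^ 9 * exp (-(485 * K)) ≤ X T' 2)
    (hcT : X T' 2 ≤ 2 * ρ ^ 2 / K ^ 10) (he0 : 0 ≤ X T' 4) :
    ∃ tz r' θ' : ℝ,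
      (T' + 1 ≤ tz ∧ X tz 1 = 0 ∧ tz < r' ∧ r' < T' + 3 ∧
        (∀ t ∈ Icc T' r', X t 2 ≤ ρ ^ 2 / K ^ 9) ∧ X r' 2 = ρ ^ 2 / K ^ 9) ∧
      (X r' 1 = θ' * ε ∧ θ' ≤ 141422 / 100000 ∧
        (θ₁ - 37 * (|X T' 3| + 4 / K ^ 9) / K ^ 9 ≤ θ' ∨ 139999 / 100000 ≤ θ') ∧
        |X r' 3 ^ 2 + X r' 4 ^ 2 - (X T' 3 ^ 2 + X T' 4 ^ 2)|
          ≤ 6 * (|X T' 3| + 3 / K ^ 9) / K ^ 9) ∧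
      (9 / 4 ≤ r' - T' ∧
        |X r' 3| ≤ |X T' 3| * exp (-(9 / 4 * (K * X T' 4))) + 3 / K ^ 9 ∧
        X T' 4 ≤ X r' 4 ∧ X r' 4 ≤ X T' 4 + 3 * K * (|X T' 3| + 3 / K ^ 9) ^ 2 ∧
        ∀ t ∈ Icc T' r', |X t 3| ≤ |X T' 3| + 3 / K ^ 9) := by
  have hK0 : (0 : ℝ) < K := by linarith
  have hK9 : (0 : ℝ) < K ^ 9 := by positivity
  have h169 : (16 : ℝ) ^ 9 ≤ K ^ 9 := pow_le_pow_left₀ (by norm_num) hK 9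
  obtain ⟨tz, r', θ', ⟨htz1, hbtz, htzr, hr'3, hcwin, hcr'⟩, ⟨hxe, hup, -, hpair⟩, hdur,
    hdcold, hmono, hegrow, hdpt⟩ :=
    knob_cold_half_clock hX h0 hK hε hεK hρ hhi hT'0 hθ1 hθ2 hbT hP hℓ hcT he0
  obtain ⟨P₀, hP₀⟩ : ∃ P₀ : ℝ, X T' 3 ^ 2 + X T' 4 ^ 2 = P₀ := ⟨_, rfl⟩
  have hP'0 : 0 ≤ P₀ := by rw [← hP₀]; positivity
  have hP'50 : P₀ ≤ 1 / 50 := by rw [← hP₀]; exact hP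
  have hP'2 : P₀ ≤ 1 / 2 := by linarith only [hP'50]
  obtain ⟨d₁, hd₁⟩ : ∃ d₁ : ℝ, d₁ = |X T' 3| + 3 / K ^ 9 := ⟨_, rfl⟩
  have hd0 : 0 ≤ d₁ := by rw [hd₁]; positivity
  have hdT : |X T' 3| ≤ 1 / 7 := by
    have h1 : X T' 3 ^ 2 ≤ (1 / 7) ^ 2 := by nlinarith only [hP, sq_nonneg (X T' 4)]
    exact abs_le.2 (abs_le_of_sq_le_sq' h1 (by norm_num))
  have h39 : (3 : ℝ) / K ^ 9 ≤ 1 / 2 := by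
    rw [div_le_div_iff₀ hK9 (by norm_num)]; linarith only [h169]
  have hd1 : d₁ ≤ 1 := by rw [hd₁]; linarith only [hdT, h39]
  have hT'r' : T' ≤ r' := by linarith only [htz1, htzr]
  have htzI : tz ∈ Icc T' r' := ⟨by linarith only [htz1], htzr.le⟩
  have hT'I : T' ∈ Icc T' r' := left_mem_Icc.2 hT'r'
  have hr'I : r' ∈ Icc T' r' := right_mem_Icc.2 hT'r'
  have hθ0 : 0 ≤ θ₁ := by linarith only [hθ1]
  have hdwin : ∀ t ∈ Icc T' r', |X t 3| ≤ d₁ := by rw [hd₁]; exact hdpt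
  -- the sharp clock increments on `[T', tz]` and `[tz, r']` (§252)
  have hinc1 := (knob_cold_increment_sharp hX h0 hK hε hεK hρ hhi hT'0 hr'3.le hθ0 hθ2 hbT hP₀
    hP'2 hcwin hdwin hT'I htzI htzI.1).1
  have hinc2 := (knob_cold_increment_sharp hX h0 hK hε hεK hρ hhi hT'0 hr'3.le hθ0 hθ2 hbT hP₀
    hP'2 hcwin hdwin htzI hr'I htzr.le).1
  rw [hbtz, hbT] at hinc1
  rw [hxe, hbtz] at hinc2
  have htz2 : (1 - P₀ - 6 * d₁ / K ^ 9 - 1 / K ^ 19) * (tz - T') ≤ θ₁ := by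
    refine le_of_mul_le_mul_left ?_ hε
    linarith only [hinc1]
  have hxlo : (1 - P₀ - 6 * d₁ / K ^ 9 - 1 / K ^ 19) * (r' - tz) ≤ θ' := by
    refine le_of_mul_le_mul_left ?_ hε
    linarith only [hinc2]
  -- the sharp alternative (§253) and the arithmetic (§254)
  have hlow := knob_relight_lower_sharp hX h0 hK hε hεK hρ hhi hT'0 hr'3.le hθ0 hθ2 hbT hP₀
    hcwin hdwin hP'2 hcT htzI hbtz hcr'
  obtain ⟨hxpos, halt⟩ := theta_lower_sharp hK hP'0 hP'50 hθ2 hd0 hd1 htz2 htzr hlow hxlo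
  have halt' : θ₁ - 37 * (|X T' 3| + 4 / K ^ 9) / K ^ 9 ≤ θ' ∨ 139999 / 100000 ≤ θ' := by
    rcases halt with h | h
    · left
      have e : d₁ + 1 / K ^ 9 = |X T' 3| + 4 / K ^ 9 := by rw [hd₁]; ring
      rw [← e]
      exact h
    · right
      have h65 : 65 / K ^ 9 ≤ (1 : ℝ) / 10 ^ 9 := by
        rw [div_le_div_iff₀ hK9 (by norm_num)]; linarith only [h169]
      have h1 : (139999 / 100000 : ℝ) ^ 2 ≤ θ' ^ 2 := by nlinarith only [h, h65, hP'50]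
      by_contra h2
      nlinarith only [h1, hxpos, not_le.1 h2]
  exact ⟨tz, r', θ', ⟨htz1, hbtz, htzr, hr'3, hcwin, hcr'⟩, ⟨hxe, hup, halt', hpair⟩, hdur,
    hdcold, hmono, hegrow, hdpt⟩

end Summit.NavierStokesRegularity.FluidComputer.GateBudget

end
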